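/-
Copyright (c) 2026. Released under Apache 2.0 license as described in the file LICENSE.
Track B ∕ K2-LIT (cell `hodgecm-mathlib`, squad K2, ENGINE E1), crux h413 = `stmt-HodgeConjecture-24833`, route of record `HCCMUnconditional`.
Prover seat `hodgecm-mathlib-K2E3-p12` (g7).  Deal «P8 PROPER» letter ℓ7 (K2E1-plan (g5) 09:23:38Z «ℓ7 = K2E3-p12»): holomorphy of Bernstein–Lapid's vectors `α₁(z) = [H^z]`, `α₂(z) = [H^{1−z}]`.
-/
import Summits.HodgeConjecture.HodgeConjecture.Theorems.K2E1BLIotaUnfoldingU        -- ★ `measurable_borelQuotHeight` (+ leaf `K2E1BLBorelSpacesU2Defs`: `HN`, `weightedTruncMeasure`, `borelQuotHeight`)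
import Literature.Analysis.Complex.SquareIntegrableHolomorphicFamily                 -- ★ uniform Cauchy estimates `norm_sub_sub_smul_deriv_le`, `norm_deriv_le_of_bound'`
import Literature.NumberTheory.Automorphic.FuchsianEisensteinHolomorphy               -- ★ `Fuchsian.rpow_le_rpow_add_rpow`
import Literature.NumberTheory.Automorphic.UnitaryGroupTorusSiegelIntegral            -- ★ `borelHeight_pos`
import HarnessLib

/-!
# K2·E1 — `K2E1BLHeightPowerHolomorphicU2`: BERNSTEIN–LAPID'S VECTORS `α₁(z) = H^z|_{Z_c}`, `α₂(z) = H^{1−z}|_{Z_c}` ARE HOLOMORPHIC FAMILIES IN `𝓗_k(Z_c)`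
# [arXiv:1911.02342, §4 Claim 5 («two holomorphic families of linearly independent vectors in 𝓗_N(Z_c)») and p. 10 («N = 1 + sup |Re s| … then α₁(s), α₂(s) ∈ 𝓗_N(Z_c)»)] — via a
# WEIGHTED form of the tree's «bounded pointwise-holomorphic families are holomorphic into L²»

Track B ∕ K2-LIT, crux h413 = `stmt-HodgeConjecture-24833`, route of record `HCCMUnconditional`; cell `hodgecm-mathlib`, squad K2, ENGINE E1 (campaign EIS-R7-BL-SPH-2, P8 letter ℓ7, ruling
09:23:38Z).  Prover seat `hodgecm-mathlib-K2E3-p12` (g7).  THEOREMS ONLY (no `def`, no `instance`, no notation, no named-fact hypothesis, no `sorry`); lane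
`--supports stmt-HodgeConjecture-24833 --as helper` (count-neutral).  Closes no socket.

WHY.  The packaged `𝔛`-system of ★ `K2E1BLXSystemPackage.exists_xSystem` carries `α₁, α₂ : ℂ → V` INSIDE the operator `A z` and the right-hand side `c z`; ★ `exists_meromorphic_solution`
(Thm 2.3) needs `A`, `c` holomorphic, hence `z ↦ α_j(z) ∈ 𝓗_k(Z_c)` holomorphic as HILBERT-SPACE-valued maps — B–L's «holomorphic families of vectors».  The family `H^z` is unbounded on
`Z_c` (H → ∞), so the tree's ★ `differentiableOn_of_bound` (uniformly bounded families) does not apply verbatim; §1 proves its WEIGHTED form (`‖f s x‖ ≤ C·W x`, `W ∈ L²`, any measure)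
by the same uniform Cauchy estimates, §2 applies it to `x ↦ (H x)^{φ(z)}` with the weight `H^{σ₀} + H^{σ₁}` (`σ₀ ≤ Re φ ≤ σ₁`), §3 instantiates on `𝓗_k(Z_c) = L²(H^{−2k}μZ|_{c < H})` where
`H^{σ} ∈ L²` for `σ ≤ k` as soon as `μZ(Z_c) < ∞` (★ `isFiniteMeasure_weightedTruncMeasure_cm` at `k = 0`).
§1 **`differentiableOn_of_weighted_bound`** (generic: `F : ℂ → L²(μ)` representing `f s` on an open `U`, `s ↦ f s x` holomorphic, `‖f s x‖ ≤ C·W x`, `W ∈ L²(μ)` ⟹ `DifferentiableOn ℂ F U`).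
§2 **`differentiableOn_Lp_cpow`** (generic: `H > 0` measurable, `H^{σ₀} + H^{σ₁} ∈ L²(μ)`, `φ` holomorphic on `U` with `σ₀ ≤ Re φ ≤ σ₁`, `F z =ᵐ (H ·)^{φ z}` ⟹ `DifferentiableOn ℂ F U`).
§3 `borelQuotHeight_pos`, **`memLp_borelQuotHeight_rpow_add_rpow`** (`H^{σ₀} + H^{σ₁} ∈ 𝓗_k(Z_c)` for `σ₀, σ₁ ≤ k`, `μZ(Z_c) < ∞`), **`differentiableOn_HN_of_ae_eq_cpow`** (THE LETTER ℓ7 in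
`=ᵐ` currency: any `α : ℂ → HN k c μZ` with `α z =ᵐ H^{φ z}` on `U`, `σ₀ ≤ Re φ ≤ σ₁ ≤ k` ⟹ holomorphic on `U`), and the two B–L instances **`differentiableOn_HN_of_ae_eq_cpow_self`** (`α₁`,
`φ = id`, on `U ⊆ {σ₀ ≤ re ≤ σ₁}`) and **`differentiableOn_HN_of_ae_eq_cpow_one_sub`** (`α₂`, `φ z = 1 − z`).
HONEST LABEL: HC_CM is proved only modulo the 7 printed citations (2 remaining named inputs: hLiu418 = `stmt-HodgeConjecture-24832`, h413 = `stmt-HodgeConjecture-24833`) until rung 0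
closes; this file asserts no named fact and closes no socket.
References: [BernsteinLapid2019] J. Bernstein, E. Lapid, *On the meromorphic continuation of Eisenstein series*, arXiv:1911.02342 (JAMS 37 (2024), doi:10.1090/jams/1020), §4 Claim 5, p. 10 ·
[Rudin1991] W. Rudin, *Functional Analysis*, 2nd ed., Thm 3.31 (weakly ∕ strongly holomorphic vector-valued functions).
-/

set_option autoImplicit false
-- the mandated namespace repeats the single-problem summit's segment (`HodgeConjecture.HodgeConjecture`)
set_option linter.dupNamespace false

noncomputable section

open MeasureTheory Filter Topology Metric Set Asymptotics NumberField
open scoped ENNReal NNReal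
open Literature.Analysis.Complex (norm_sub_sub_smul_deriv_le norm_deriv_le_of_bound')
open Literature.NumberTheory.Automorphic Literature.NumberTheory.Automorphic.UnitaryGroup
open Summit.HodgeConjecture.HodgeConjecture.Cruxes.H413.K2E1BLBorelSpacesU2Defs
open Summit.HodgeConjecture.HodgeConjecture.Cruxes.H413.K2E1BLIotaUnfoldingU (measurable_borelQuotHeight)

namespace Summit.HodgeConjecture.HodgeConjecture.Cruxes.H413.K2E1BLHeightPowerHolomorphicU2

/-! ## §1 Weighted form of «pointwise-holomorphic dominated families are holomorphic into `L²`» -/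

section Weighted

variable {X : Type*} [MeasurableSpace X] {μ : Measure X}

/-- **A DOMINATED family `f(s, ·)`, holomorphic in the parameter pointwise, defines a holomorphic map into `L²(μ)`** — weighted form of ★ `Literature.Analysis.Complex.differentiableOn_of_bound`
(there `W = 1` on a finite measure space): `F : ℂ → L²(μ)` represents `f s` for `s` in the open `U`, each `s ↦ f s x` is complex differentiable on `U`, each `f s` is a.e.-strongly measurable,
and `‖f s x‖ ≤ C · W x` on `U × X` with `W ∈ L²(μ)`; then `F` is complex differentiable on `U`.  Proof: the uniform Cauchy estimates ★ `norm_sub_sub_smul_deriv_le` ∕ ★ `norm_deriv_le_of_bound'`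
applied with the pointwise constant `C · W x` give `‖f(s₀+h, x) − f(s₀, x) − h·∂f(s₀, x)‖ ≤ (4CW(x)∕r²)‖h‖²`, whence `‖F(s₀+h) − F(s₀) − h·D‖ ≤ (4C‖W‖₂∕r²)‖h‖²`. [cite: Rudin1991, Thm 3.31]
[cite: BernsteinLapid2019, §4 Claim 5] -/
theorem differentiableOn_of_weighted_bound {f : ℂ → X → ℂ} {U : Set ℂ} (hU : IsOpen U) (hdiff : ∀ x, DifferentiableOn ℂ (fun s => f s x) U)
    (hmeas : ∀ s ∈ U, AEStronglyMeasurable (f s) μ) {W : X → ℝ} (hW : MemLp W 2 μ) {C : ℝ} (hC0 : 0 ≤ C) (hC : ∀ s ∈ U, ∀ x, ‖f s x‖ ≤ C * W x) {F : ℂ → Lp ℂ 2 μ}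
    (hF : ∀ s ∈ U, (F s : X → ℂ) =ᵐ[μ] f s) : DifferentiableOn ℂ F U := by
  intro s₀ hs₀
  have hW0 : ∀ x, 0 ≤ C * W x := fun x => (norm_nonneg _).trans (hC s₀ hs₀ x)
  -- a disc `closedBall s₀ (2r) ⊆ U`
  obtain ⟨ρ, hρ, hρU⟩ := Metric.isOpen_iff.mp hU s₀ hs₀
  obtain ⟨r, hr⟩ : ∃ r : ℝ, r = ρ / 4 := ⟨_, rfl⟩
  have hr0 : 0 < r := by rw [hr]; positivity
  have hsub : closedBall s₀ (2 * r) ⊆ U := by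
    refine Subset.trans ?_ hρU
    intro z hz
    rw [mem_closedBall] at hz
    rw [mem_ball]
    linarith
  have hmemU : ∀ {h : ℂ}, ‖h‖ ≤ r / 2 → s₀ + h ∈ U := fun {h} hh =>
    hsub (by rw [mem_closedBall, dist_eq_norm, add_sub_cancel_left]; linarith)
  -- the derivative, pointwise, dominated by `(C / r) · W`
  obtain ⟨d, hd⟩ : ∃ d : X → ℂ, d = fun x => deriv (fun s => f s x) s₀ := ⟨_, rfl⟩
  have hdx : ∀ x, HasDerivAt (fun s => f s x) (d x) s₀ := fun x => by
    rw [hd]; exact ((hdiff x s₀ hs₀).differentiableAt (hU.mem_nhds hs₀)).hasDerivAt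
  have hdbound : ∀ x, ‖d x‖ ≤ C * W x / r := fun x => by
    rw [hd]; exact norm_deriv_le_of_bound' (hdiff x) (fun z hz => hC z hz x) hr0 hsub
  -- measurability of `d` as a pointwise limit of difference quotients
  obtain ⟨tseq, htseq⟩ : ∃ tseq : ℕ → ℝ, tseq = fun n : ℕ => (r / 2) / ((n : ℝ) + 1) := ⟨_, rfl⟩
  have htpos : ∀ n, 0 < tseq n := fun n => by rw [htseq]; positivity
  have htle : ∀ n, tseq n ≤ r / 2 := fun n => by
    rw [htseq]
    exact div_le_self (by linarith) (by linarith [(Nat.cast_nonneg n : (0 : ℝ) ≤ n)])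
  have htend : Tendsto tseq atTop (𝓝 0) := by
    rw [htseq]
    exact tendsto_const_nhds.div_atTop (tendsto_natCast_atTop_atTop.atTop_add tendsto_const_nhds)
  have htend' : Tendsto (fun n => ((tseq n : ℝ) : ℂ)) atTop (𝓝[≠] 0) := by
    rw [tendsto_nhdsWithin_iff]
    refine ⟨?_, Eventually.of_forall fun n => ?_⟩
    · have := (Complex.continuous_ofReal.tendsto 0).comp htend
      rw [Complex.ofReal_zero] at this
      exact this
    · simp only [mem_compl_iff, mem_singleton_iff, Complex.ofReal_eq_zero]
      exact (htpos n).ne'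
  obtain ⟨q, hq⟩ : ∃ q : ℕ → X → ℂ, q = fun n x => ((tseq n : ℝ) : ℂ)⁻¹ • (f (s₀ + (tseq n : ℂ)) x - f s₀ x) := ⟨_, rfl⟩
  have hqm : ∀ n, AEStronglyMeasurable (q n) μ := by
    intro n
    have hmem : s₀ + ((tseq n : ℝ) : ℂ) ∈ U := hmemU (by rw [Complex.norm_real, Real.norm_of_nonneg (htpos n).le]; exact htle n)
    rw [hq]
    exact ((hmeas _ hmem).sub (hmeas s₀ hs₀)).const_smul ((((tseq n : ℝ) : ℂ))⁻¹)
  have hqlim : ∀ᵐ x ∂μ, Tendsto (fun n => q n x) atTop (𝓝 (d x)) := by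
    refine Eventually.of_forall fun x => ?_
    rw [hq]
    exact (hdx x).tendsto_slope_zero.comp htend'
  have hdm : AEStronglyMeasurable d μ := aestronglyMeasurable_of_tendsto_ae atTop hqm hqlim
  have hdmem : MemLp d 2 μ := by
    refine (hW.const_mul (C / r)).of_le hdm (Eventually.of_forall fun x => ?_)
    calc ‖d x‖ ≤ C * W x / r := hdbound x
      _ = C / r * W x := by ring
      _ ≤ ‖C / r * W x‖ := Real.le_norm_self _
  obtain ⟨D, hD⟩ : ∃ D : Lp ℂ 2 μ, D = hdmem.toLp d := ⟨_, rfl⟩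
  -- the second-order bound, pointwise and in `L²`
  have hrem : ∀ {h : ℂ}, ‖h‖ ≤ r / 2 → ∀ x, ‖f (s₀ + h) x - f s₀ x - h • d x‖ ≤ 4 * (C * W x) / r ^ 2 * ‖h‖ ^ 2 := fun {h} hh x => by
    rw [hd]; exact norm_sub_sub_smul_deriv_le hU (hdiff x) (fun z hz => hC z hz x) hr0 hsub hh
  have hnorm : ∀ {h : ℂ}, ‖h‖ ≤ r / 2 → ‖F (s₀ + h) - F s₀ - h • D‖ ≤ 4 * C / r ^ 2 * ‖h‖ ^ 2 * ‖hW.toLp W‖ := by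
    intro h hh
    refine Lp.norm_le_mul_norm_of_ae_le_mul ?_
    filter_upwards [Lp.coeFn_sub (F (s₀ + h) - F s₀) (h • D), Lp.coeFn_sub (F (s₀ + h)) (F s₀), Lp.coeFn_smul h D, hF _ (hmemU hh), hF s₀ hs₀, hdmem.coeFn_toLp,
      hW.coeFn_toLp] with x h1 h2 h3 h4 h5 h6 h7
    rw [h1, Pi.sub_apply, h2, Pi.sub_apply, h3, Pi.smul_apply, h4, h5, hD, h6, h7]
    calc ‖f (s₀ + h) x - f s₀ x - h • d x‖ ≤ 4 * (C * W x) / r ^ 2 * ‖h‖ ^ 2 := hrem hh x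
      _ = 4 * C / r ^ 2 * ‖h‖ ^ 2 * W x := by ring
      _ ≤ 4 * C / r ^ 2 * ‖h‖ ^ 2 * ‖W x‖ := mul_le_mul_of_nonneg_left (Real.le_norm_self _) (by positivity)
  -- `HasDerivAt F D s₀`
  have hderiv : HasDerivAt F D s₀ := by
    rw [hasDerivAt_iff_isLittleO_nhds_zero]
    have hbig : (fun h => F (s₀ + h) - F s₀ - h • D) =O[𝓝 0] fun h : ℂ => ‖h‖ ^ 2 := by
      refine IsBigO.of_bound (4 * C / r ^ 2 * ‖hW.toLp W‖) ?_
      have hev : ∀ᶠ h : ℂ in 𝓝 0, ‖h‖ ≤ r / 2 := by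
        have : Metric.closedBall (0 : ℂ) (r / 2) ∈ 𝓝 (0 : ℂ) := closedBall_mem_nhds 0 (by linarith)
        filter_upwards [this] with h hh
        rwa [mem_closedBall, dist_zero_right] at hh
      filter_upwards [hev] with h hh
      refine (hnorm hh).trans (le_of_eq ?_)
      rw [Real.norm_of_nonneg (by positivity)]
      ring
    exact hbig.trans_isLittleO (isLittleO_norm_pow_id one_lt_two)
  exact hderiv.differentiableAt.differentiableWithinAt

/-! ## §2 The power family `x ↦ (H x)^{φ(z)}` -/

/-- Pointwise bound: `‖(H x)^{w}‖ = (H x)^{Re w} ≤ (H x)^{σ₀} + (H x)^{σ₁}` for `H x > 0` and `σ₀ ≤ Re w ≤ σ₁` (★ `Fuchsian.rpow_le_rpow_add_rpow`). [folklore] -/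
theorem norm_ofReal_cpow_le_rpow_add_rpow {t : ℝ} (ht : 0 < t) {w : ℂ} {σ₀ σ₁ : ℝ} (h0 : σ₀ ≤ w.re) (h1 : w.re ≤ σ₁) :
    ‖((t : ℂ) ^ w)‖ ≤ t ^ σ₀ + t ^ σ₁ := by
  rw [Complex.norm_cpow_eq_rpow_re_of_pos ht]
  exact Fuchsian.rpow_le_rpow_add_rpow ht h0 h1

/-- **THE POWER FAMILY IS HOLOMORPHIC INTO `L²`** (generic): `H : X → ℝ` measurable and positive, `H^{σ₀} + H^{σ₁} ∈ L²(μ)`, `φ` holomorphic on the open `U` with `σ₀ ≤ Re φ(z) ≤ σ₁` there, and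
`F : ℂ → L²(μ)` with `F z =ᵐ (H ·)^{φ z}` for `z ∈ U`; then `F` is complex differentiable on `U` (§1 with `W = H^{σ₀} + H^{σ₁}`, `C = 1`). [cite: BernsteinLapid2019, §4 Claim 5 and p. 10]
[cite: Rudin1991, Thm 3.31] -/
theorem differentiableOn_Lp_cpow {H : X → ℝ} (hHm : Measurable H) (hHpos : ∀ x, 0 < H x) {σ₀ σ₁ : ℝ} (hW : MemLp (fun x => H x ^ σ₀ + H x ^ σ₁) 2 μ) {φ : ℂ → ℂ} {U : Set ℂ}
    (hU : IsOpen U) (hφ : DifferentiableOn ℂ φ U) (hφre : ∀ z ∈ U, σ₀ ≤ (φ z).re ∧ (φ z).re ≤ σ₁) {F : ℂ → Lp ℂ 2 μ}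
    (hF : ∀ z ∈ U, (F z : X → ℂ) =ᵐ[μ] fun x => ((H x : ℝ) : ℂ) ^ φ z) : DifferentiableOn ℂ F U := by
  refine differentiableOn_of_weighted_bound (f := fun z x => ((H x : ℝ) : ℂ) ^ φ z) hU (fun x => ?_) (fun z _ => ?_) hW zero_le_one (fun z hz x => ?_) hF
  · exact hφ.const_cpow (Or.inl (Complex.ofReal_ne_zero.2 (hHpos x).ne'))
  · exact ((Complex.measurable_ofReal.comp hHm).pow_const (φ z)).aestronglyMeasurable
  · rw [one_mul]
    exact norm_ofReal_cpow_le_rpow_add_rpow (hHpos x) (hφre z hz).1 (hφre z hz).2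

end Weighted

/-! ## §3 Bernstein–Lapid's `α₁(z) = H^z|_{Z_c}`, `α₂(z) = H^{1−z}|_{Z_c}` in `𝓗_k(Z_c)` -/

section BL

variable {F E : Type} [Field F] [NumberField F] [Field E] [NumberField E] [Algebra F E] {c : E ≃ₐ[F] E} {N : ℕ} [NeZero N]

/-- The height on `Z` is positive (★ `borelHeight_pos` on representatives). [cite: BernsteinLapid2019, §4 p. 9] -/
theorem borelQuotHeight_pos (z : borelQuotient F E c N) : 0 < ((borelQuotHeight F E c N z : ℝ≥0) : ℝ) := by
  induction z using Quotient.inductionOn with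
  | h g => exact_mod_cast borelHeight_pos g

/-- **`H^{σ₀} + H^{σ₁} ∈ 𝓗_k(Z_c)` for `σ₀, σ₁ ≤ k` once `μZ(Z_c) < ∞`**: on `Z_c = {c < H}` the integrand `(H^{σ₀} + H^{σ₁})²·H^{−2k}` is bounded by `2(c^{2σ₀−2k} + c^{2σ₁−2k})` (exponents
`≤ 0`, base `≥ c`). [cite: BernsteinLapid2019, §4 p. 10 («then α₁(s), α₂(s) ∈ 𝓗_N(Z_c)»)] -/
theorem memLp_borelQuotHeight_rpow_add_rpow {k : ℕ} {c₁ : ℝ≥0} (hc₁ : 0 < c₁) {μZ : Measure (borelQuotient F E c N)} (hfin : μZ {z | c₁ < borelQuotHeight F E c N z} ≠ ∞)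
    {σ₀ σ₁ : ℝ} (hσ₀ : σ₀ ≤ k) (hσ₁ : σ₁ ≤ k) :
    MemLp (fun z => ((borelQuotHeight F E c N z : ℝ≥0) : ℝ) ^ σ₀ + ((borelQuotHeight F E c N z : ℝ≥0) : ℝ) ^ σ₁) 2 (weightedTruncMeasure F E c N k c₁ μZ) := by
  have hHm : Measurable fun z => ((borelQuotHeight F E c N z : ℝ≥0) : ℝ) := measurable_borelQuotHeight.coe_nnreal_real
  have hWm : AEStronglyMeasurable (fun z => ((borelQuotHeight F E c N z : ℝ≥0) : ℝ) ^ σ₀ + ((borelQuotHeight F E c N z : ℝ≥0) : ℝ) ^ σ₁) (weightedTruncMeasure F E c N k c₁ μZ) :=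
    ((hHm.pow_const σ₀).add (hHm.pow_const σ₁)).aestronglyMeasurable
  have hdNN : Measurable fun z : borelQuotient F E c N => ((borelQuotHeight F E c N z)⁻¹ ^ (2 * k) : ℝ≥0) := measurable_borelQuotHeight.inv.pow_const _
  rw [memLp_two_iff_integrable_sq hWm, weightedTruncMeasure, integrable_withDensity_iff_integrable_coe_smul hdNN]
  -- a bounded integrand on a set of finite measure
  have hS : MeasurableSet {z : borelQuotient F E c N | c₁ < borelQuotHeight F E c N z} := measurableSet_lt measurable_const measurable_borelQuotHeight
  refine Measure.integrableOn_of_bounded (M := 2 * ((c₁ : ℝ) ^ (2 * σ₀ - 2 * k) + (c₁ : ℝ) ^ (2 * σ₁ - 2 * k))) hfin ?_ ?_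
  · exact ((hdNN.coe_nnreal_real).smul (((hHm.pow_const σ₀).add (hHm.pow_const σ₁)).pow_const _)).aestronglyMeasurable
  · rw [ae_restrict_iff' hS]
    refine Eventually.of_forall fun z (hz : c₁ < borelQuotHeight F E c N z) => ?_
    have hH : 0 < ((borelQuotHeight F E c N z : ℝ≥0) : ℝ) := borelQuotHeight_pos z
    have hcH : (c₁ : ℝ) < ((borelQuotHeight F E c N z : ℝ≥0) : ℝ) := by exact_mod_cast hz
    have hc : (0 : ℝ) < c₁ := by exact_mod_cast hc₁
    -- `H^{-2k} (H^{σ₀} + H^{σ₁})² ≤ 2 (H^{2σ₀-2k} + H^{2σ₁-2k}) ≤ 2 (c^{2σ₀-2k} + c^{2σ₁-2k})`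
    have hpow : ∀ σ : ℝ, σ ≤ k → ((((borelQuotHeight F E c N z : ℝ≥0)⁻¹ ^ (2 * k) : ℝ≥0) : ℝ)) * (((borelQuotHeight F E c N z : ℝ≥0) : ℝ) ^ σ) ^ 2 ≤ (c₁ : ℝ) ^ (2 * σ - 2 * k) := by
      intro σ hσ
      have h1 : ((((borelQuotHeight F E c N z : ℝ≥0)⁻¹ ^ (2 * k) : ℝ≥0) : ℝ)) = ((borelQuotHeight F E c N z : ℝ≥0) : ℝ) ^ (-(2 * (k : ℝ))) := by
        rw [NNReal.coe_pow, NNReal.coe_inv, Real.rpow_neg hH.le, ← Real.rpow_natCast, ← Real.inv_rpow hH.le]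
        norm_cast
      rw [h1, ← Real.rpow_natCast, ← Real.rpow_mul hH.le, ← Real.rpow_add hH]
      have h2 : -(2 * (k : ℝ)) + σ * ((2 : ℕ) : ℝ) = 2 * σ - 2 * k := by push_cast; ring
      rw [h2]
      exact Real.rpow_le_rpow_of_nonpos hc hcH.le (by linarith)
    rw [norm_smul, Real.norm_of_nonneg (by positivity), Real.norm_of_nonneg (by positivity)]
    have hsq : (((borelQuotHeight F E c N z : ℝ≥0) : ℝ) ^ σ₀ + ((borelQuotHeight F E c N z : ℝ≥0) : ℝ) ^ σ₁) ^ 2 ≤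
        2 * ((((borelQuotHeight F E c N z : ℝ≥0) : ℝ) ^ σ₀) ^ 2 + (((borelQuotHeight F E c N z : ℝ≥0) : ℝ) ^ σ₁) ^ 2) := by
      nlinarith [sq_nonneg (((borelQuotHeight F E c N z : ℝ≥0) : ℝ) ^ σ₀ - ((borelQuotHeight F E c N z : ℝ≥0) : ℝ) ^ σ₁)]
    have hnn : 0 ≤ ((((borelQuotHeight F E c N z : ℝ≥0)⁻¹ ^ (2 * k) : ℝ≥0) : ℝ)) := by positivity
    have h0 := hpow σ₀ hσ₀
    have h1 := hpow σ₁ hσ₁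
    have hA : 0 ≤ (c₁ : ℝ) ^ (2 * σ₀ - 2 * k) := by positivity
    have hB : 0 ≤ (c₁ : ℝ) ^ (2 * σ₁ - 2 * k) := by positivity
    nlinarith [mul_le_mul_of_nonneg_left hsq hnn]

/-- **LETTER ℓ7 (a.e. currency)**: any `α : ℂ → 𝓗_k(Z_c)` with `α z =ᵐ H^{φ(z)}` on an open `U`, `φ` holomorphic on `U` with `σ₀ ≤ Re φ ≤ σ₁`, `σ₀, σ₁ ≤ k`, `μZ(Z_c) < ∞`, is HOLOMORPHIC on `U`.
[cite: BernsteinLapid2019, §4 Claim 5 and p. 10] [cite: Rudin1991, Thm 3.31] -/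
theorem differentiableOn_HN_of_ae_eq_cpow {k : ℕ} {c₁ : ℝ≥0} (hc₁ : 0 < c₁) {μZ : Measure (borelQuotient F E c N)} (hfin : μZ {z | c₁ < borelQuotHeight F E c N z} ≠ ∞)
    {σ₀ σ₁ : ℝ} (hσ₀ : σ₀ ≤ k) (hσ₁ : σ₁ ≤ k) {φ : ℂ → ℂ} {U : Set ℂ} (hU : IsOpen U) (hφ : DifferentiableOn ℂ φ U) (hφre : ∀ z ∈ U, σ₀ ≤ (φ z).re ∧ (φ z).re ≤ σ₁)
    {α : ℂ → HN F E c N k c₁ μZ} (hα : ∀ z ∈ U, (α z : borelQuotient F E c N → ℂ) =ᵐ[weightedTruncMeasure F E c N k c₁ μZ] fun x => (((borelQuotHeight F E c N x : ℝ≥0) : ℝ) : ℂ) ^ φ z) :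
    DifferentiableOn ℂ α U :=
  differentiableOn_Lp_cpow measurable_borelQuotHeight.coe_nnreal_real borelQuotHeight_pos (memLp_borelQuotHeight_rpow_add_rpow hc₁ hfin hσ₀ hσ₁) hU hφ hφre hα

/-- **`α₁(z) = H^z|_{Z_c}` IS HOLOMORPHIC** on any open `U ⊆ {σ₀ ≤ Re z ≤ σ₁}` with `σ₀, σ₁ ≤ k`, `μZ(Z_c) < ∞` (in `=ᵐ` currency: `α z =ᵐ H^z` on `U`). [cite: BernsteinLapid2019, §4 p. 10] -/
theorem differentiableOn_HN_of_ae_eq_cpow_self {k : ℕ} {c₁ : ℝ≥0} (hc₁ : 0 < c₁) {μZ : Measure (borelQuotient F E c N)} (hfin : μZ {z | c₁ < borelQuotHeight F E c N z} ≠ ∞)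
    {σ₀ σ₁ : ℝ} (hσ₀ : σ₀ ≤ k) (hσ₁ : σ₁ ≤ k) {U : Set ℂ} (hU : IsOpen U) (hUre : ∀ z ∈ U, σ₀ ≤ z.re ∧ z.re ≤ σ₁)
    {α : ℂ → HN F E c N k c₁ μZ} (hα : ∀ z ∈ U, (α z : borelQuotient F E c N → ℂ) =ᵐ[weightedTruncMeasure F E c N k c₁ μZ] fun x => (((borelQuotHeight F E c N x : ℝ≥0) : ℝ) : ℂ) ^ z) :
    DifferentiableOn ℂ α U :=
  differentiableOn_HN_of_ae_eq_cpow hc₁ hfin hσ₀ hσ₁ hU differentiableOn_id hUre hα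

/-- **`α₂(z) = H^{1−z}|_{Z_c}` IS HOLOMORPHIC** on any open `U ⊆ {1 − σ₁ ≤ Re z ≤ 1 − σ₀}` with `σ₀, σ₁ ≤ k`, `μZ(Z_c) < ∞` (in `=ᵐ` currency). [cite: BernsteinLapid2019, §4 p. 10] -/
theorem differentiableOn_HN_of_ae_eq_cpow_one_sub {k : ℕ} {c₁ : ℝ≥0} (hc₁ : 0 < c₁) {μZ : Measure (borelQuotient F E c N)} (hfin : μZ {z | c₁ < borelQuotHeight F E c N z} ≠ ∞)
    {σ₀ σ₁ : ℝ} (hσ₀ : σ₀ ≤ k) (hσ₁ : σ₁ ≤ k) {U : Set ℂ} (hU : IsOpen U) (hUre : ∀ z ∈ U, σ₀ ≤ 1 - z.re ∧ 1 - z.re ≤ σ₁)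
    {α : ℂ → HN F E c N k c₁ μZ} (hα : ∀ z ∈ U, (α z : borelQuotient F E c N → ℂ) =ᵐ[weightedTruncMeasure F E c N k c₁ μZ] fun x => (((borelQuotHeight F E c N x : ℝ≥0) : ℝ) : ℂ) ^ (1 - z)) :
    DifferentiableOn ℂ α U :=
  differentiableOn_HN_of_ae_eq_cpow (φ := fun z : ℂ => 1 - z) hc₁ hfin hσ₀ hσ₁ hU (differentiableOn_id.const_sub (1 : ℂ))
    (fun z hz => by simpa only [Complex.sub_re, Complex.one_re] using hUre z hz) hα

end BL

end Summit.HodgeConjecture.HodgeConjecture.Cruxes.H413.K2E1BLHeightPowerHolomorphicU2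

end
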